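import Summits.QuantumFields.YangMills.Theorems.LangevinControlUVFemtoCurvatureTwoPointCTorusLower
import Summits.QuantumFields.YangMills.Theorems.LangevinControlUVFemtoCurvatureTwoPointCTorusUpper
import Summits.QuantumFields.YangMills.Theorems.LangevinControlUVFemtoCurvatureTwoPointCBirthVarianceEvenDoubling
import HarnessLib

/-!
# Route `LangevinControlUV`, crux `FemtoCurvatureTwoPointC` (stmt-QuantumFields-16204), line `birth` —
# bulk assembly of the torus free-energy sandwich: uniform doubling, mean action, even variance

Registered wave-5 sub-goals `uniformDoubling_bulk`, `meanAction_bulk`, `varianceCeilingEven_bulk`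
(`--supports stmt-QuantumFields-16204`), proved verbatim. Setting: a compact group `G` with a
faithful continuous unitary lattice representation `r` (`D = dimE r.ρ`), the torus `(ℤ/L)⁴`,
Wilson's action `S = wilsonAction r.ρ`, the partition function `Z_L(β) = partitionFunction r.ρ β`
and the Wilson expectation `⟨·⟩_β = wilsonExpectation r.ρ β`.

These are the first **volume-UNIFORM** weak-coupling bounds on the torus in this tree, valid in
the bulk regime `2 ≤ β ≤ e^L` (`log β ≤ L`), `L ≥ 2`:

* `uniformDoubling_bulk` — ONE constant `A = A(r)` with `Z_L(β/2) ≤ e^{A L⁴} Z_L(β)`;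
* `meanAction_bulk` — `β ⟨S⟩_β ≤ A L⁴`, i.e. `⟨S⟩_β ≤ A L⁴ / β` (equipartition order, one `A`);
* `varianceCeilingEven_bulk` — on EVEN tori, `Var_β(P_0^{01}) = ⟨P_0 P_0⟩_β − ⟨P_0⟩_β² ≤ C / β²`
  with ONE `C = 16 e^{A} / e²`, `P_x = N − Re tr r.ρ(U_{x;01})` the `01`-plaquette field.

This is a PARTIAL DISCHARGE of the crux's variance-ceiling stub V (which is stated for all window
boxes): the deep-femto corner `β > e^L` of the window stays open (it is the boundary/holonomy
sector of the sandwich, where the `(D/2)(L³+L²+L+1) log β` slack is no longer `O(L⁴)`), and so do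
odd tori.

**Proof.** The torus free-energy sandwich, both halves LANDED: the gauge-fixed Gaussian lower
bound `e^{−A₀ L⁴} (C₁ β^{−D/2})^{3L⁴+1} ≤ Z_L(β)` (`β ≥ 1`, `torusPartitionFunction_lower`, file
`…CTorusLower`, p146937) and the triangular upper bound `Z_L(β) ≤ (C β^{−D/2})^{3L⁴ − L³ − L² − L}`
(`L ≥ 2`, `β ≥ 1`, `torusPartitionFunction_upper`, file `…CTorusUpper`, p146095). Taking
logarithms at `β/2 ≥ 1` (upper) and at `β` (lower) and subtracting,

  `log Z_L(β/2) − log Z_L(β) ≤ (D/2)(L³+L²+L+1) log β + O(L⁴) ≤ D L⁴ + O(L⁴)`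

as soon as `log β ≤ L` (`L³+L²+L+1 ≤ 2L³` for `L ≥ 2`); explicitly
`A = 3D + 4|log C| + 4|log C₁| + |A₀|` works (`doubling_bookkeeping`). The mean action bound is
the Gibbs–Jensen supporting-line inequality `(β − β/2) ⟨S⟩_β ≤ log Z_L(β/2) − log Z_L(β)`
(`mul_wilsonExpectation_wilsonAction_le` of `WilsonEnergyConvexity`). The even variance ceiling is
the argument of the landed `bareVarianceEven_of_uniformDoubling` (p141134) run pointwise at
`(L, β)`: `Var P_0 ≤ ⟨P_0²⟩_β ≤ ⟨∏ₓ P_x²⟩_β^{1/L⁴}` (chessboard estimate on even tori,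
`plaquetteChessboardEven_holds`, p114602) and
`⟨∏ₓ P_x²⟩_β ≤ (4/(eβ))^{2L⁴} Z_L(β/2)/Z_L(β) ≤ ((4/(eβ))² e^{A})^{L⁴}` (AM–GM,
`PlaquetteVariance.wilsonExpectation_prod_sq_le`, and the doubling), the second countability of
`G` needed by the sandwich being read off the faithful representation `r`.

Everything is proved from Mathlib and landed tree files; no named facts, no new definitions.
-/

set_option autoImplicit false

noncomputable section

open MeasureTheory
open Literature.MathematicalPhysics.QuantumFieldTheory
open Summit.QuantumFields.YangMills.Theorems.FreeEnergyLogCoefficient (dimE)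
open Summit.QuantumFields.YangMills.Theorems.FemtoCurvatureTwoPoint.PlaquetteVariance
open Summit.QuantumFields.YangMills.Cruxes.FemtoCurvatureTwoPoint.GenericStepGammaEncoding
  (PlaquetteChessboardEven plaquetteChessboardEven_holds)

namespace Summit.QuantumFields.YangMills.Theorems.FemtoCurvatureTwoPointC.TorusGauge

/-! ### The bookkeeping inequality -/

/-- **Bookkeeping of the sandwich exponents.** With `M = 3L⁴ − (L³+L²+L)` plaquettes in the upper
bound, `3L⁴ + 1` off-comb links in the lower bound, `0 ≤ ℓ = log β ≤ L`, `l₂ = log 2 ≤ 1`,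
`D ≥ 0` and `L ≥ 2`:
`M (log C − (D/2)(ℓ − l₂)) − (−A₀ L⁴ + (3L⁴+1)(log C₁ − (D/2) ℓ)) ≤ (3D + 4|log C| + 4|log C₁| + |A₀|) L⁴`
(the `log β` terms leave `(L³+L²+L+1)(D/2) ℓ ≤ 2L³ · (D/2) · L = D L⁴`). -/
theorem doubling_bookkeeping {L D A₀ lC lC₁ l₂ ℓ : ℝ} (hL : 2 ≤ L) (hD : 0 ≤ D)
    (hℓ0 : 0 ≤ ℓ) (hℓ : ℓ ≤ L) (hl1 : l₂ ≤ 1) :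
    (3 * L ^ 4 - (L ^ 3 + L ^ 2 + L)) * (lC + -(D / 2) * (ℓ - l₂)) -
        (-(A₀ * L ^ 4) + (3 * L ^ 4 + 1) * (lC₁ + -(D / 2) * ℓ)) ≤
      (3 * D + 4 * |lC| + 4 * |lC₁| + |A₀|) * L ^ 4 := by
  have hL0 : 0 ≤ L := by linarith
  -- `L² + L + 1 ≤ L³` and `2 L³ ≤ L⁴` for `L ≥ 2`
  have h1 : L ^ 2 + L + 1 ≤ L ^ 3 := by
    nlinarith [mul_nonneg (sub_nonneg.2 hL) (by positivity : (0 : ℝ) ≤ L ^ 2 + L)]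
  have h2 : 2 * L ^ 3 ≤ L ^ 4 := by
    nlinarith [mul_nonneg (sub_nonneg.2 hL) (by positivity : (0 : ℝ) ≤ L ^ 3)]
  have hL4 : 1 ≤ L ^ 4 := one_le_pow₀ (by linarith : (1 : ℝ) ≤ L)
  -- the cardinalities `M = 3L⁴ − (L³+L²+L)` and `3L⁴ + 1` lie in `[0, 4L⁴]` and differ by `≤ 2L³`
  have hM0 : 0 ≤ 3 * L ^ 4 - (L ^ 3 + L ^ 2 + L) := by nlinarith
  have hM4 : 3 * L ^ 4 - (L ^ 3 + L ^ 2 + L) ≤ 4 * L ^ 4 := by nlinarith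
  have hN4 : 3 * L ^ 4 + 1 ≤ 4 * L ^ 4 := by linarith
  have hNM : L ^ 3 + L ^ 2 + L + 1 ≤ 2 * L ^ 3 := by linarith
  -- termwise bounds
  have ha : (3 * L ^ 4 - (L ^ 3 + L ^ 2 + L)) * lC ≤ 4 * L ^ 4 * |lC| := by
    nlinarith [mul_nonneg hM0 (sub_nonneg.2 (le_abs_self lC)),
      mul_nonneg (sub_nonneg.2 hM4) (abs_nonneg lC)]
  have hb : (3 * L ^ 4 - (L ^ 3 + L ^ 2 + L)) * (D / 2 * l₂) ≤ 4 * L ^ 4 * (D / 2) := by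
    nlinarith [mul_nonneg hM0 (mul_nonneg (by linarith : 0 ≤ D / 2) (sub_nonneg.2 hl1)),
      mul_nonneg (sub_nonneg.2 hM4) (by linarith : 0 ≤ D / 2)]
  have hc : (L ^ 3 + L ^ 2 + L + 1) * (D / 2 * ℓ) ≤ D * L ^ 4 := by
    have ht0 : 0 ≤ D / 2 * ℓ := by positivity
    nlinarith [mul_nonneg (sub_nonneg.2 hNM) ht0,
      mul_nonneg (by positivity : 0 ≤ L ^ 3 * D) (sub_nonneg.2 hℓ)]
  have hd : A₀ * L ^ 4 ≤ |A₀| * L ^ 4 := mul_le_mul_of_nonneg_right (le_abs_self _) (by positivity)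
  have he : -((3 * L ^ 4 + 1) * lC₁) ≤ 4 * L ^ 4 * |lC₁| := by
    nlinarith [mul_nonneg (by positivity : 0 ≤ 3 * L ^ 4 + 1) (sub_nonneg.2 (neg_le_abs lC₁)),
      mul_nonneg (sub_nonneg.2 hN4) (abs_nonneg lC₁)]
  nlinarith [ha, hb, hc, hd, he]

/-! ### The registered statements -/

/-- **Uniform torus free-energy doubling in the bulk** (registered wave-5 sub-goal of line `birth`,
crux `FemtoCurvatureTwoPointC`, stmt-QuantumFields-16204; the signature verbatim): for a compact
second-countable group `G` with a faithful continuous unitary lattice representation `r` there is ONE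
`A` with `Z_L(β/2) ≤ e^{A L⁴} Z_L(β)` for every torus `(ℤ/L)⁴`, `L ≥ 2`, and every `2 ≤ β ≤ e^L` — the
logarithm of the torus sandwich (`torusPartitionFunction_upper` at `β/2`, `torusPartitionFunction_lower`
at `β`) and the bookkeeping `doubling_bookkeeping`. -/
theorem uniformDoubling_bulk :
    ∀ {G : Type} [Group G] [TopologicalSpace G] [IsTopologicalGroup G] [CompactSpace G]
      [MeasurableSpace G] [BorelSpace G] [SecondCountableTopology G] (r : LatticeRep G),
      ∃ A : ℝ, ∀ (L : ℕ) [NeZero L] (β : ℝ), 2 ≤ L → 2 ≤ β → Real.log β ≤ L →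
        (partitionFunction (d := 4) (L := L) r.ρ (β / 2)).toReal ≤
          Real.exp (A * (L : ℝ) ^ 4) * (partitionFunction (d := 4) (L := L) r.ρ β).toReal := by
  intro G _ _ _ _ _ _ _ r
  obtain ⟨C₁, A₀, hC₁, hlow⟩ := torusPartitionFunction_lower r
  obtain ⟨C, hC, hup⟩ := torusPartitionFunction_upper r
  refine ⟨3 * (dimE r.ρ : ℝ) + 4 * |Real.log C| + 4 * |Real.log C₁| + |A₀|,
    fun L _ β hL hβ hlogβ => ?_⟩
  have hβ0 : 0 < β := by linarith
  have hβ1 : 1 ≤ β := by linarith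
  have hβh : 1 ≤ β / 2 := by linarith
  have hβh0 : 0 < β / 2 := by linarith
  have hL2 : (2 : ℝ) ≤ L := by exact_mod_cast hL
  have hZh := partitionFunction_toReal_pos (d := 4) (L := L) r.ρ r.continuous (β / 2)
  have hZb := partitionFunction_toReal_pos (d := 4) (L := L) r.ρ r.continuous β
  -- the two power laws `x = (β/2)^{-D/2}`, `y = β^{-D/2}` and their logarithms
  have hx : 0 < (β / 2) ^ (-((dimE r.ρ : ℝ) / 2)) := Real.rpow_pos_of_pos hβh0 _
  have hy : 0 < β ^ (-((dimE r.ρ : ℝ) / 2)) := Real.rpow_pos_of_pos hβ0 _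
  have hlogx : Real.log ((β / 2) ^ (-((dimE r.ρ : ℝ) / 2))) =
      -((dimE r.ρ : ℝ) / 2) * (Real.log β - Real.log 2) := by
    rw [Real.log_rpow hβh0, Real.log_div hβ0.ne' two_ne_zero]
  have hlogy : Real.log (β ^ (-((dimE r.ρ : ℝ) / 2))) = -((dimE r.ρ : ℝ) / 2) * Real.log β :=
    Real.log_rpow hβ0 _
  -- the cardinality of the top-link plaquette family, as a real number
  have hMle : L ^ 3 + L ^ 2 + L ≤ 3 * L ^ 4 := by
    have h1 : 1 ≤ L := by omega
    have h3 : L ^ 3 ≤ L ^ 4 := Nat.pow_le_pow_right h1 (by norm_num)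
    have h2 : L ^ 2 ≤ L ^ 4 := Nat.pow_le_pow_right h1 (by norm_num)
    have h0 : L ^ 1 ≤ L ^ 4 := Nat.pow_le_pow_right h1 (by norm_num)
    rw [pow_one] at h0
    omega
  have hM : ((3 * L ^ 4 - (L ^ 3 + L ^ 2 + L) : ℕ) : ℝ) =
      3 * (L : ℝ) ^ 4 - ((L : ℝ) ^ 3 + (L : ℝ) ^ 2 + L) := by
    rw [Nat.cast_sub hMle]
    push_cast
    ring
  -- UPPER half of the sandwich at `β/2 ≥ 1`, in logarithmic form
  have hU : Real.log (partitionFunction (d := 4) (L := L) r.ρ (β / 2)).toReal ≤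
      (3 * (L : ℝ) ^ 4 - ((L : ℝ) ^ 3 + (L : ℝ) ^ 2 + L)) *
        (Real.log C + -((dimE r.ρ : ℝ) / 2) * (Real.log β - Real.log 2)) := by
    have h := Real.log_le_log hZh (hup L (β / 2) hL hβh)
    rwa [Real.log_pow, Real.log_mul hC.ne' hx.ne', hlogx, hM] at h
  -- LOWER half of the sandwich at `β ≥ 1`, in logarithmic form
  have hLo : -(A₀ * (L : ℝ) ^ 4) + (3 * (L : ℝ) ^ 4 + 1) *
        (Real.log C₁ + -((dimE r.ρ : ℝ) / 2) * Real.log β) ≤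
      Real.log (partitionFunction (d := 4) (L := L) r.ρ β).toReal := by
    have hpos : 0 < Real.exp (-(A₀ * (L : ℝ) ^ 4)) *
        (C₁ * β ^ (-((dimE r.ρ : ℝ) / 2))) ^ (3 * L ^ 4 + 1) :=
      mul_pos (Real.exp_pos _) (pow_pos (mul_pos hC₁ hy) _)
    have h := Real.log_le_log hpos (hlow L β hβ1)
    rw [Real.log_mul (Real.exp_pos _).ne' (pow_pos (mul_pos hC₁ hy) _).ne', Real.log_exp,
      Real.log_pow, Real.log_mul hC₁.ne' hy.ne', hlogy] at h
    push_cast at h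
    exact h
  -- bookkeeping: the difference of the two logarithms is `≤ A L⁴` in the bulk `log β ≤ L`
  have hbook := doubling_bookkeeping (A₀ := A₀) (lC := Real.log C) (lC₁ := Real.log C₁) hL2
    (Nat.cast_nonneg (dimE r.ρ)) (Real.log_nonneg hβ1) hlogβ
    ((Real.log_le_sub_one_of_pos two_pos).trans (by norm_num))
  -- exponentiate
  rw [← Real.log_le_log_iff hZh (mul_pos (Real.exp_pos _) hZb),
    Real.log_mul (Real.exp_pos _).ne' hZb.ne', Real.log_exp]
  linarith

/-- **Volume-uniform mean action bound in the bulk** (registered wave-5 sub-goal of line `birth`, crux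
`FemtoCurvatureTwoPointC`, stmt-QuantumFields-16204; the signature verbatim): ONE `A` with
`β ⟨S⟩_β ≤ A L⁴` for every torus `(ℤ/L)⁴`, `L ≥ 2`, and `2 ≤ β ≤ e^L` — the Gibbs–Jensen supporting-line
inequality `(β − β/2) ⟨S⟩_β ≤ log Z_L(β/2) − log Z_L(β)` (`mul_wilsonExpectation_wilsonAction_le`) and the
uniform doubling `uniformDoubling_bulk` (whose constant is doubled). -/
theorem meanAction_bulk :
    ∀ {G : Type} [Group G] [TopologicalSpace G] [IsTopologicalGroup G] [CompactSpace G]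
      [MeasurableSpace G] [BorelSpace G] [SecondCountableTopology G] (r : LatticeRep G),
      ∃ A : ℝ, ∀ (L : ℕ) [NeZero L] (β : ℝ), 2 ≤ L → 2 ≤ β → Real.log β ≤ L →
        β * wilsonExpectation r.ρ β (fun U : GaugeConfig 4 L G => wilsonAction r.ρ U) ≤ A * (L : ℝ) ^ 4 := by
  intro G _ _ _ _ _ _ _ r
  obtain ⟨A, hA⟩ := uniformDoubling_bulk r
  refine ⟨2 * A, fun L _ β hL hβ hlogβ => ?_⟩
  have hZh := partitionFunction_toReal_pos (d := 4) (L := L) r.ρ r.continuous (β / 2)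
  have hZb := partitionFunction_toReal_pos (d := 4) (L := L) r.ρ r.continuous β
  -- the doubling in logarithmic form
  have hdbl : Real.log (partitionFunction (d := 4) (L := L) r.ρ (β / 2)).toReal ≤
      A * (L : ℝ) ^ 4 + Real.log (partitionFunction (d := 4) (L := L) r.ρ β).toReal := by
    have h := Real.log_le_log hZh (hA L β hL hβ hlogβ)
    rwa [Real.log_mul (Real.exp_pos _).ne' hZb.ne', Real.log_exp] at h
  -- Gibbs–Jensen at `(β, β/2)`
  have hGJ := mul_wilsonExpectation_wilsonAction_le (d := 4) (L := L) r.ρ r.continuous β (β / 2)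
  unfold Literature.MathematicalPhysics.QuantumLattice.torusLogPartition at hGJ
  have hE : wilsonExpectation r.ρ β (fun U : GaugeConfig 4 L G => wilsonAction r.ρ U) =
      wilsonExpectation r.ρ β (wilsonAction (d := 4) (L := L) (G := G) r.ρ) := rfl
  rw [hE]
  linarith

/-- **The variance ceiling on even tori in the bulk, volume-uniform** (registered wave-5 sub-goal of
line `birth`, crux `FemtoCurvatureTwoPointC`, stmt-QuantumFields-16204; the signature verbatim; a partial
discharge of the crux's stub V): ONE `C = 16 e^{A} / e²` with
`⟨P_0 P_0⟩_β − ⟨P_0⟩_β² ≤ C · (β²)⁻¹` for every EVEN torus `(ℤ/L)⁴`, `L ≥ 2`, and `2 ≤ β ≤ e^L`,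
`P_0 = N − Re tr r.ρ(U_{0;01})` — the argument of `bareVarianceEven_of_uniformDoubling` (chessboard
estimate p114602 + AM–GM) run pointwise with the doubling `uniformDoubling_bulk`, the second
countability of `G` being read off the faithful representation `r`. -/
theorem varianceCeilingEven_bulk :
    ∀ {G : Type} [Group G] [TopologicalSpace G] [IsTopologicalGroup G] [CompactSpace G]
      [MeasurableSpace G] [BorelSpace G] (r : LatticeRep G),
      ∃ C : ℝ, ∀ (L : ℕ) [NeZero L], Even L → 2 ≤ L → ∀ β : ℝ, 2 ≤ β → Real.log β ≤ L →
        ∀ (P : (Fin 4 → ZMod L) → Fin 4 → Fin 4 → GaugeConfig 4 L G → ℝ)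
          (E : (GaugeConfig 4 L G → ℝ) → ℝ),
          (P = fun x i j U => (r.N : ℝ) - (r.ρ (plaquetteHolonomy U x i j)).trace.re) →
          (E = fun F => wilsonExpectation r.ρ β F) →
          E (fun U => P 0 0 1 U * P 0 0 1 U) - E (P 0 0 1) * E (P 0 0 1) ≤ C * (β ^ 2)⁻¹ := by
  intro G i1 i2 i3 i4 i5 i6 r
  -- `G` is second countable: it embeds into `M_N(ℂ)` through the faithful `r`
  haveI : SecondCountableTopology (Matrix (Fin r.N) (Fin r.N) ℂ) :=
    inferInstanceAs (SecondCountableTopology (Fin r.N → Fin r.N → ℂ))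
  haveI : SecondCountableTopology G :=
    (r.continuous.isClosedEmbedding r.injective).isEmbedding.secondCountableTopology
  obtain ⟨A, hA⟩ := uniformDoubling_bulk r
  refine ⟨16 * Real.exp A / Real.exp 1 ^ 2, ?_⟩
  intro L iL hL h2 β hβ hlogβ P E hP hE
  subst hP hE
  dsimp only
  have hβ1 : 1 ≤ β := by linarith
  have hβ0 : 0 < β := by linarith
  -- the doubling at `(L, β)`
  have hdbl : (partitionFunction (d := 4) (L := L) r.ρ (β / 2)).toReal ≤
      Real.exp (A * (L : ℝ) ^ 4) * (partitionFunction (d := 4) (L := L) r.ρ β).toReal :=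
    hA L β h2 hβ hlogβ
  -- (i) `|Var P| ≤ ⟨P²⟩`
  have hXm := measurable_plaq01 r.ρ r.continuous (0 : Site 4 L)
  have hXb : ∀ U : GaugeConfig 4 L G,
      |(r.N : ℝ) - (r.ρ (plaquetteHolonomy U 0 0 1)).trace.re| ≤ 2 * r.N := fun U => by
    obtain ⟨h0, h2'⟩ := plaqField_mem r.ρ r.continuous (plaquetteHolonomy U 0 0 1)
    rw [abs_of_nonneg h0]
    exact h2'
  have hvar := abs_var_le_wilsonExpectation_sq r.ρ r.continuous β hXm hXb
  -- (ii) chessboard (landed, all even tori) with `f = min (t², 4N²)`, `f(P_x) = P_x²`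
  have hCh : PlaquetteChessboardEven := plaquetteChessboardEven_holds
  unfold PlaquetteChessboardEven at hCh
  have hmin : ∀ (U : GaugeConfig 4 L G) (x : Site 4 L),
      min (((r.N : ℝ) - (r.ρ (plaquetteHolonomy U x 0 1)).trace.re) ^ 2) ((2 * (r.N : ℝ)) ^ 2) =
        ((r.N : ℝ) - (r.ρ (plaquetteHolonomy U x 0 1)).trace.re) ^ 2 := fun U x => by
    obtain ⟨h0, h2'⟩ := plaqField_mem r.ρ r.continuous (plaquetteHolonomy U x 0 1)
    exact min_eq_left (pow_le_pow_left₀ h0 h2' 2)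
  have hf := hCh G r.N r.ρ r.continuous r.mem_unitary L hL β hβ0.le
    (fun t => min (t ^ 2) ((2 * (r.N : ℝ)) ^ 2))
    ((continuous_id.pow 2).min continuous_const).measurable
    (fun t => le_min (sq_nonneg t) (sq_nonneg _)) ⟨(2 * (r.N : ℝ)) ^ 2, fun t => min_le_right _ _⟩
  simp only [hmin] at hf
  -- (iii)–(v) `⟨∏ₓ P_x²⟩ ≤ M^{L⁴}` with `M = (4/(eβ))² e^{A}`
  have hprod : wilsonExpectation r.ρ β (fun U : GaugeConfig 4 L G =>
      ∏ x : Site 4 L, ((r.N : ℝ) - (r.ρ (plaquetteHolonomy U x 0 1)).trace.re) ^ 2) ≤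
        ((4 / (Real.exp 1 * β)) ^ 2 * Real.exp A) ^ (L ^ 4) := by
    refine (wilsonExpectation_prod_sq_le r.ρ r.continuous hβ0).trans ?_
    have hZ := partitionFunction_toReal_pos (d := 4) (L := L) r.ρ r.continuous β
    have hratio : (partitionFunction (d := 4) (L := L) r.ρ (β / 2)).toReal /
        (partitionFunction (d := 4) (L := L) r.ρ β).toReal ≤ Real.exp (A * (L : ℝ) ^ 4) := by
      rw [div_le_iff₀ hZ]
      exact hdbl
    calc (4 / (Real.exp 1 * β)) ^ (2 * L ^ 4) *
          ((partitionFunction (d := 4) (L := L) r.ρ (β / 2)).toReal /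
            (partitionFunction (d := 4) (L := L) r.ρ β).toReal)
        ≤ (4 / (Real.exp 1 * β)) ^ (2 * L ^ 4) * Real.exp (A * (L : ℝ) ^ 4) :=
          mul_le_mul_of_nonneg_left hratio (pow_nonneg (by positivity) _)
      _ = ((4 / (Real.exp 1 * β)) ^ 2 * Real.exp A) ^ (L ^ 4) := by
          rw [pow_mul, mul_pow, ← Real.exp_nat_mul]
          congr 2
          push_cast
          ring
  -- (vi) the `L⁴`-th root
  have hroot : (wilsonExpectation r.ρ β (fun U : GaugeConfig 4 L G =>
      ∏ x : Site 4 L, ((r.N : ℝ) - (r.ρ (plaquetteHolonomy U x 0 1)).trace.re) ^ 2)) ^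
        ((1 : ℝ) / (L : ℝ) ^ 4) ≤ (4 / (Real.exp 1 * β)) ^ 2 * Real.exp A := by
    have h0 : 0 ≤ wilsonExpectation r.ρ β (fun U : GaugeConfig 4 L G =>
        ∏ x : Site 4 L, ((r.N : ℝ) - (r.ρ (plaquetteHolonomy U x 0 1)).trace.re) ^ 2) :=
      wilsonExpectation_nonneg r.ρ β fun U => Finset.prod_nonneg fun x _ => sq_nonneg _
    have hM0 : 0 ≤ (4 / (Real.exp 1 * β)) ^ 2 * Real.exp A := by positivity
    have hk0 : L ^ 4 ≠ 0 := pow_ne_zero 4 (NeZero.ne L)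
    calc _ ≤ (((4 / (Real.exp 1 * β)) ^ 2 * Real.exp A) ^ (L ^ 4)) ^ ((1 : ℝ) / (L : ℝ) ^ 4) :=
          Real.rpow_le_rpow h0 hprod (by positivity)
      _ = (4 / (Real.exp 1 * β)) ^ 2 * Real.exp A := by
          rw [one_div, ← Nat.cast_pow]
          exact Real.pow_rpow_inv_natCast hM0 hk0
  -- assembly: `Var ≤ |Var| ≤ ⟨P²⟩ ≤ ⟨∏ₓ P_x²⟩^{1/L⁴} ≤ (4/(eβ))² e^{A} = C · (β²)⁻¹`
  have hβne : β ≠ 0 := hβ0.ne'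
  calc _ ≤ (4 / (Real.exp 1 * β)) ^ 2 * Real.exp A :=
        (le_abs_self _).trans (hvar.trans (hf.trans hroot))
    _ = 16 * Real.exp A / Real.exp 1 ^ 2 * (β ^ 2)⁻¹ := by
        field_simp
        ring

end Summit.QuantumFields.YangMills.Theorems.FemtoCurvatureTwoPointC.TorusGauge

end
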